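import Literature.AlgebraicTopology.Homotopy.CubeSkeletalExtension
import Literature.Geometry.Manifold.ChartTower
import Literature.Geometry.Manifold.CompactSubsetEmbedding
import Mathlib.Analysis.InnerProductSpace.PiL2
import HarnessLib

/-!
# Compact pieces of a topological manifold factor through finite cube complexes up to homotopy

Topic `Literature/AlgebraicTopology/Homotopy`. The manifold-side input of Milnor's theorem that
(noncompact, second countable, Hausdorff) manifolds have the homotopy type of countable CW
complexes (Milnor, *On spaces having the homotopy type of a CW-complex* (1959), Cor. 1, proved
there from "every separable manifold is an ANR" (Hanner) and Thm. 1), in the local and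
quantitative form that the telescope argument of `ManifoldCountableCWType.lean` consumes:

* `Literature.AlgebraicTopology.Homotopy.exists_cube_factorization`: for a compact `K` inside
  an open `U` of a locally compact metric space with an atlas of charts on `ℝⁿ` there are a
  finite lattice cube complex `P = LatticeCube.complex 𝒬 h ⊆ ℝᴺ`, a continuous `F : M → ℝᴺ`
  with `F(K) ⊆ P`, a map `b : ℝᴺ → M` continuous on `P` with `b(P) ⊆ U`, and a jointly
  continuous homotopy `H : K × [0,1] → U` from the inclusion of `K` to `b ∘ F|K`.

The proof is the tree's version of Hatcher's cube-by-cube extension (*Algebraic Topology*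
(2002), proof of Thm. A.7, p. 527) run twice through the relative skeletal extension theorem
`SkelData.exists_extension` (`CubeSkeletalExtension.lean`): `F` injects a compact neighbourhood
`L` of `K` into `ℝᴺ` (`exists_continuous_injOn_nhds_pi_of_isCompact`); `𝒬` = cubes of a fine
mesh `h` meeting `F(K)`; anchors = points of `K` over the corners; the chart tower of
`exists_chartTower` around `L`; first `b` on `P` (no prescribed faces), then the homotopy on the
prism complex `P × [0, h] ⊆ ℝᴺ⁺¹` (`Prism.liftCube`), with bottom prescribed `= x` and top
`= b`, the point `x ∈ K` being carried as a parameter with parameter sets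
`{x ∈ K | F x ∈ star of the face}`. Also: `exists_forall_dist_lt_of_injOn` (uniformly continuous
inverse of an injection of a compact set) and the prism face bookkeeping `Prism.*`.
No named facts, no `sorry`.

## References

* J. Milnor, *On spaces having the homotopy type of a CW-complex*, Trans. AMS 90 (1959),
  Cor. 1 and its proof (pp. 272–273), Lemma 4 (p. 279). [Milnor1959]
* A. Hatcher, *Algebraic Topology*, CUP (2002), Appendix, proof of Thm. A.7 (p. 527).
  [HatcherAT2002]
-/

noncomputable section

open Set Metric Function
open Literature.Topology.Euclidean Literature.Topology.Euclidean.LatticeCube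

namespace Literature.AlgebraicTopology.Homotopy

namespace Prism

variable {N : ℕ} {h : ℝ}

/-- The cube `b × [0, h]` of the lattice of `ℝᴺ⁺¹`: lower corner `(b, 0)`. [folklore] -/
def liftCube (b : Fin N → ℤ) : Fin (N + 1) → ℤ := Fin.snoc b 0

/-- `liftCube` on the first `N` coordinates. [folklore] -/
@[simp]
theorem liftCube_castSucc (b : Fin N → ℤ) (i : Fin N) : liftCube b i.castSucc = b i := by
  simp [liftCube]

/-- `liftCube` on the last coordinate. [folklore] -/
@[simp]
theorem liftCube_last (b : Fin N → ℤ) : liftCube b (Fin.last N) = 0 := by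
  simp [liftCube]

/-- The projection of a face of `ℝᴺ⁺¹` to its first `N` coordinates. [folklore] -/
def proj (G : Face (N + 1)) : Face N := by
  classical
  exact ⟨fun i => G.a i.castSucc, Finset.univ.filter fun i => i.castSucc ∈ G.S⟩

/-- The corner of the projected face. [folklore] -/
@[simp]
theorem proj_a (G : Face (N + 1)) (i : Fin N) : (proj G).a i = G.a i.castSucc := rfl

/-- The free directions of the projected face. [folklore] -/
@[simp]
theorem mem_proj_S (G : Face (N + 1)) (i : Fin N) : i ∈ (proj G).S ↔ i.castSucc ∈ G.S := by
  classical
  simp [proj]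

/-- A face of `b × [0, h]` projects to a face of `b`. [folklore] -/
theorem proj_isFaceOf {G : Face (N + 1)} {b : Fin N → ℤ} (hG : G.IsFaceOf (liftCube b)) :
    (proj G).IsFaceOf b := by
  intro i
  have h1 := hG i.castSucc
  rw [liftCube_castSucc] at h1
  refine ⟨fun hi => h1.1 ((mem_proj_S G i).1 hi), fun hi => h1.2 fun h' => hi ((mem_proj_S G i).2 h')⟩

/-- The last corner coordinate of a face of `b × [0, h]` is `0` or `1`. [folklore] -/
theorem a_last_of_isFaceOf {G : Face (N + 1)} {b : Fin N → ℤ} (hG : G.IsFaceOf (liftCube b)) :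
    G.a (Fin.last N) = 0 ∨ G.a (Fin.last N) = 1 := by
  have h1 := hG (Fin.last N)
  rw [liftCube_last] at h1
  by_cases hS : Fin.last N ∈ G.S
  · exact Or.inl (h1.1 hS)
  · rcases h1.2 hS with h2 | h2
    · exact Or.inl h2
    · exact Or.inr (by rw [h2]; ring)

/-- A point of a face of `ℝᴺ⁺¹` projects into the projected face. [folklore] -/
theorem init_mem_carrier_proj {G : Face (N + 1)} {y : Fin (N + 1) → ℝ} (hy : y ∈ G.carrier h) :
    Fin.init y ∈ (proj G).carrier h := by
  intro i
  have h1 := hy i.castSucc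
  simp only [Fin.init, proj_a, mem_proj_S]
  exact h1

/-- The last coordinate of a point of a face of `b × [0, h]` with the last direction frozen.
[folklore] -/
theorem apply_last_of_not_mem {G : Face (N + 1)} {y : Fin (N + 1) → ℝ} (hy : y ∈ G.carrier h)
    (hS : Fin.last N ∉ G.S) : y (Fin.last N) = (G.a (Fin.last N) : ℝ) * h :=
  (hy (Fin.last N)).2 hS

/-- Projection commutes with freezing the last direction. [folklore] -/
theorem proj_bdFace_last (G : Face (N + 1)) (up : Bool) : proj (G.bdFace (Fin.last N) up) = proj G := by
  classical
  ext i
  · simp only [proj_a]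
    exact Face.bdFace_a_of_ne G up (Fin.castSucc_lt_last i).ne
  · simp only [mem_proj_S, Face.bdFace_S, Finset.mem_erase]
    exact ⟨fun h' => h'.2, fun h' => ⟨(Fin.castSucc_lt_last i).ne, h'⟩⟩

/-- Projection commutes with freezing one of the first `N` directions. [folklore] -/
theorem proj_bdFace_castSucc (G : Face (N + 1)) (j : Fin N) (up : Bool) :
    proj (G.bdFace j.castSucc up) = (proj G).bdFace j up := by
  classical
  ext i
  · simp only [proj_a]
    by_cases hij : i = j
    · subst hij
      cases up
      · rw [Face.bdFace_a_self_false, Face.bdFace_a_self_false, proj_a]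
      · rw [Face.bdFace_a_self_true, Face.bdFace_a_self_true, proj_a]
    · rw [Face.bdFace_a_of_ne G up (fun h' => hij (Fin.castSucc_injective N h')),
        Face.bdFace_a_of_ne (proj G) up hij, proj_a]
  · simp only [mem_proj_S, Face.bdFace_S, Finset.mem_erase]
    exact ⟨fun h' => ⟨fun hij => h'.1 (hij ▸ rfl), h'.2⟩,
      fun h' => ⟨fun hij => h'.1 (Fin.castSucc_injective N hij), h'.2⟩⟩

/-- A face with the last direction frozen has the dimension of its projection. [folklore] -/
theorem card_proj_S_of_not_mem {G : Face (N + 1)} (hS : Fin.last N ∉ G.S) :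
    (proj G).S.card = G.S.card := by
  classical
  -- `castSucc` is a bijection from `(proj G).S` onto `G.S`
  refine Finset.card_bij (fun i _ => i.castSucc) (fun i hi => (mem_proj_S G i).1 hi)
    (fun i _ i' _ h' => Fin.castSucc_injective N h') (fun k hk => ?_)
  have hk' : k ≠ Fin.last N := fun h' => hS (h' ▸ hk)
  obtain ⟨i, rfl⟩ := Fin.exists_castSucc_eq.2 hk'
  exact ⟨i, (mem_proj_S G i).2 hk, rfl⟩

/-- The top cube of `b × [0, h]` projects to the top cube of `b`. [folklore] -/
@[simp]
theorem proj_top (b : Fin N → ℤ) : proj (Face.top (N + 1) (liftCube b)) = Face.top N b := by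
  classical
  ext i
  · simp [proj, Face.top, liftCube]
  · simp [proj, Face.top]

/-- `snoc y s` lies in `b × [0, h]` iff `y ∈ b` and `0 ≤ s ≤ h`. [folklore] -/
theorem snoc_mem_carrier_top {b : Fin N → ℤ} {y : Fin N → ℝ} {s : ℝ} (hy : y ∈ (Face.top N b).carrier h)
    (hs : 0 ≤ s ∧ s ≤ h) : (Fin.snoc y s : Fin (N + 1) → ℝ) ∈ (Face.top (N + 1) (liftCube b)).carrier h := by
  rw [Face.mem_carrier_top]
  intro i
  refine Fin.lastCases ?_ (fun j => ?_) i
  · rw [Fin.snoc_last, liftCube_last]; push_cast; constructor <;> linarith [hs.1, hs.2]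
  · rw [Fin.snoc_castSucc, liftCube_castSucc]; exact (Face.mem_carrier_top.1 hy) j

/-- The bottom (`up = false`, last coordinate `0`) and top (`up = true`, last coordinate `h`)
faces of `b × [0, h]`. [folklore] -/
def lid (b : Fin N → ℤ) (up : Bool) : Face (N + 1) := (Face.top (N + 1) (liftCube b)).bdFace (Fin.last N) up

/-- The last direction of a lid is frozen. [folklore] -/
theorem last_not_mem_lid_S (b : Fin N → ℤ) (up : Bool) : Fin.last N ∉ (lid b up).S := by
  simp [lid, Face.bdFace_S]

/-- `snoc y 0` lies in the bottom lid, `snoc y h` in the top lid, of every cube containing `y`.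
[folklore] -/
theorem snoc_mem_carrier_lid {b : Fin N → ℤ} {y : Fin N → ℝ} (hy : y ∈ (Face.top N b).carrier h)
    (up : Bool) :
    (Fin.snoc y (if up then h else 0) : Fin (N + 1) → ℝ) ∈ (lid b up).carrier h := by
  intro i
  refine Fin.lastCases ?_ (fun j => ?_) i
  · constructor
    · intro hi; exact absurd hi (last_not_mem_lid_S b up)
    · intro _
      rw [Fin.snoc_last]
      cases up
      · simp [lid, Face.bdFace_a_self_false]
      · simp [lid, Face.bdFace_a_self_true]
  · have hj : (j.castSucc : Fin (N + 1)) ≠ Fin.last N := (Fin.castSucc_lt_last j).ne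
    have hyj := (Face.mem_carrier_top.1 hy) j
    rw [Fin.snoc_castSucc]
    simp only [lid, Face.bdFace_S, Face.top_S, Finset.mem_erase, Finset.mem_univ, and_true, ne_eq,
      hj, not_false_eq_true, true_implies, not_true_eq_false, false_implies, and_true]
    rw [Face.bdFace_a_of_ne _ up hj, Face.top_a, liftCube_castSucc]
    exact hyj

/-- The lids are faces of the prism complex. [folklore] -/
theorem lid_mem_faces {𝒬 : Finset (Fin N → ℤ)} {b : Fin N → ℤ} (hb : b ∈ 𝒬) (up : Bool) :
    lid b up ∈ faces (𝒬.image liftCube) :=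
  ⟨liftCube b, Finset.mem_image_of_mem _ hb,
    Face.bdFace_isFaceOf (Face.top_isFaceOf _) (Finset.mem_univ _) up⟩

/-- The full prism cube is a face of the prism complex. [folklore] -/
theorem top_liftCube_mem_faces {𝒬 : Finset (Fin N → ℤ)} {b : Fin N → ℤ} (hb : b ∈ 𝒬) :
    Face.top (N + 1) (liftCube b) ∈ faces (𝒬.image liftCube) :=
  ⟨liftCube b, Finset.mem_image_of_mem _ hb, Face.top_isFaceOf _⟩

/-- Faces of the prism complex project to faces of the base complex. [folklore] -/
theorem proj_mem_faces {𝒬 : Finset (Fin N → ℤ)} {G : Face (N + 1)} (hG : G ∈ faces (𝒬.image liftCube)) :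
    proj G ∈ faces 𝒬 := by
  obtain ⟨b', hb', hGb'⟩ := hG
  obtain ⟨b, hb, rfl⟩ := Finset.mem_image.1 hb'
  exact ⟨b, hb, proj_isFaceOf hGb'⟩

/-- A face of the prism complex is a face of `b × [0, h]` for some `b ∈ 𝒬`. [folklore] -/
theorem exists_isFaceOf_liftCube {𝒬 : Finset (Fin N → ℤ)} {G : Face (N + 1)}
    (hG : G ∈ faces (𝒬.image liftCube)) : ∃ b ∈ 𝒬, G.IsFaceOf (liftCube b) := by
  obtain ⟨b', hb', hGb'⟩ := hG
  obtain ⟨b, hb, rfl⟩ := Finset.mem_image.1 hb'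
  exact ⟨b, hb, hGb'⟩

end Prism

end Literature.AlgebraicTopology.Homotopy

end

noncomputable section

open Set Metric Function
open Literature.Topology.Euclidean Literature.Topology.Euclidean.LatticeCube
open Literature.Geometry.Manifold

namespace Literature.AlgebraicTopology.Homotopy

/-! ### Uniform continuity of the inverse of an injection of a compact set -/

/-- **An injective continuous map on a compact set has uniformly continuous inverse**: for
`ε > 0` there is `δ > 0` with `dist (f x) (f y) < δ → dist x y < ε` on `L`. [folklore] -/
theorem exists_forall_dist_lt_of_injOn {X Y : Type*} [MetricSpace X] [MetricSpace Y] {f : X → Y}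
    {L : Set X} (hL : IsCompact L) (hf : ContinuousOn f L) (hinj : InjOn f L) {ε : ℝ} (hε : 0 < ε) :
    ∃ δ > 0, ∀ x ∈ L, ∀ y ∈ L, dist (f x) (f y) < δ → dist x y < ε := by
  -- the compact set of far-apart pairs
  set P : Set (X × X) := (L ×ˢ L) ∩ {p | ε ≤ dist p.1 p.2} with hP
  have hPc : IsCompact P := (hL.prod hL).inter_right (isClosed_le continuous_const continuous_dist)
  rcases P.eq_empty_or_nonempty with hPe | hPne
  · refine ⟨1, one_pos, fun x hx y hy _ => ?_⟩
    by_contra hxy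
    have : (x, y) ∈ P := ⟨⟨hx, hy⟩, not_lt.1 hxy⟩
    rw [hPe] at this
    exact this
  · have hφ : ContinuousOn (fun p : X × X => dist (f p.1) (f p.2)) P :=
      continuous_dist.comp_continuousOn
        ((hf.comp continuous_fst.continuousOn fun p (hp : p ∈ P) => hp.1.1).prodMk
          (hf.comp continuous_snd.continuousOn fun p (hp : p ∈ P) => hp.1.2))
    obtain ⟨p₀, hp₀, hmin⟩ := hPc.exists_isMinOn hPne hφ
    have hpos : 0 < dist (f p₀.1) (f p₀.2) := by
      rw [dist_pos]
      intro heq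
      have := hinj hp₀.1.1 hp₀.1.2 heq
      have h2 : ε ≤ dist p₀.1 p₀.2 := hp₀.2
      rw [this, dist_self] at h2
      exact absurd h2 (not_le.2 hε)
    refine ⟨dist (f p₀.1) (f p₀.2), hpos, fun x hx y hy hxy => ?_⟩
    by_contra hfar
    have hmem : (x, y) ∈ P := ⟨⟨hx, hy⟩, not_lt.1 hfar⟩
    exact absurd (hmin hmem) (not_le.2 hxy)

/-! ### The factorisation theorem -/

section Factorization

variable {M : Type*} [MetricSpace M] [LocallyCompactSpace M]

/-- The union of the cubes of `𝒬` having `G` as a face. [folklore] -/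
def starU {N : ℕ} (𝒬 : Finset (Fin N → ℤ)) (h : ℝ) (G : Face N) : Set (Fin N → ℝ) :=
  ⋃ b ∈ 𝒬, ⋃ (_ : G.IsFaceOf b), (Face.top N b).carrier h

/-- **Compact pieces of a manifold factor through finite cube complexes, up to a small homotopy.**
For a compact `K` inside an open `U` of a (metric, locally compact, nonempty) space with an atlas
of charts on `ℝⁿ`: there are a finite lattice cube complex `P = LatticeCube.complex 𝒬 h ⊆ ℝᴺ`,
a continuous `F : M → ℝᴺ` with `F(K) ⊆ P`, a map `b : P → U` continuous on `P`, and a homotopy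
`H : K × [0, 1] → U` (jointly continuous) from the inclusion of `K` to `b ∘ F`. (This is the
local, compact form of "separable manifolds are ANRs, hence dominated by locally finite
complexes" — Milnor 1959, proof of Cor. 1 via Hanner; Hatcher 2002, proof of Thm. A.7 — proved
by two skeletal inductions over `P` and over the prism `P × [0, h]`, filling cells by coning in
charts along a chart tower.) [cite: Milnor1959, Cor. 1 (proof, p. 273)] [cite: HatcherAT2002, Thm. A.7 (proof, p. 527)] -/
theorem exists_cube_factorization {n : ℕ} [ChartedSpace (EuclideanSpace ℝ (Fin n)) M] [Nonempty M]
    {K U : Set M} (hK : IsCompact K) (hU : IsOpen U) (hKU : K ⊆ U) :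
    ∃ (N : ℕ) (h : ℝ) (𝒬 : Finset (Fin N → ℤ)) (F : M → (Fin N → ℝ)) (b : (Fin N → ℝ) → M)
      (H : M → ℝ → M),
      0 < h ∧ Continuous F ∧ (∀ x ∈ K, F x ∈ complex 𝒬 h) ∧ ContinuousOn b (complex 𝒬 h) ∧
      (∀ y ∈ complex 𝒬 h, b y ∈ U) ∧
      ContinuousOn (fun q : M × ℝ => H q.1 q.2) (K ×ˢ Icc 0 1) ∧
      (∀ x ∈ K, H x 0 = x) ∧ (∀ x ∈ K, H x 1 = b (F x)) ∧
      (∀ x ∈ K, ∀ t ∈ Icc (0 : ℝ) 1, H x t ∈ U) := by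
  classical
  set E := EuclideanSpace ℝ (Fin n) with hE
  -- Step 1: an injection of a compact neighbourhood `L` of `K` into `ℝᴺ`
  obtain ⟨L, N, F, hLc, hKL, hLU, hFc, hFinj⟩ :=
    exists_continuous_injOn_nhds_pi_of_isCompact (M := M) E hK hU hKU
  have hKL' : K ⊆ L := hKL.trans interior_subset
  -- Step 2: the chart tower around `L`, with `N + 1` levels
  obtain ⟨r, ρ, ctr, σ, hrpos, hrmono, hρ, hρr, hrU, htower⟩ :=
    exists_chartTower (H := E) hLc hU hLU (N + 1)
  have hrmono' : ∀ k k', k ≤ k' → r k ≤ r k' := by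
    intro k k' hkk'
    induction hkk' with
    | refl => exact le_rfl
    | step _ ih => exact ih.trans (hrmono _)
  -- Step 3: uniform continuity of `F⁻¹` on `L`, and the mesh
  obtain ⟨δ, hδ, hδF⟩ := exists_forall_dist_lt_of_injOn hLc hFc.continuousOn
    (fun x hx y _ hxy => hFinj x hx y hxy) (lt_min hρ (hrpos 0))
  set h : ℝ := δ / 4 with hhdef
  have hh : 0 < h := by positivity
  have h3 : 3 * h < δ := by rw [hhdef]; linarith
  -- Step 4: the cubes meeting `F(K)`
  have hZc : IsCompact (F '' K) := hK.image hFc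
  have hfin := finite_setOf_carrier_top_inter_nonempty hh hZc.isBounded (N := N)
  set 𝒬 : Finset (Fin N → ℤ) := hfin.toFinset with h𝒬
  have hmem𝒬 : ∀ {b}, b ∈ 𝒬 ↔ ((Face.top N b).carrier h ∩ F '' K).Nonempty := by
    intro b; rw [h𝒬, Set.Finite.mem_toFinset]; rfl
  have hFK : ∀ x ∈ K, (fun i => ⌊F x i / h⌋) ∈ 𝒬 ∧ F x ∈ (Face.top N fun i => ⌊F x i / h⌋).carrier h :=
    fun x hx => ⟨hmem𝒬.2 ⟨F x, mem_carrier_top_floor hh (F x), x, hx, rfl⟩, mem_carrier_top_floor hh (F x)⟩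
  -- Step 5: points of `K` over the lattice points, and the anchors
  have hxOf : ∀ v : Fin N → ℝ, ∃ x : M, (∃ x' ∈ K, dist (F x') v ≤ h) → x ∈ K ∧ dist (F x) v ≤ h := by
    intro v
    by_cases hv : ∃ x' ∈ K, dist (F x') v ≤ h
    · obtain ⟨x', hx', hd⟩ := hv; exact ⟨x', fun _ => ⟨hx', hd⟩⟩
    · exact ⟨Classical.arbitrary M, fun h' => absurd h' hv⟩
  choose xOf hxOf using hxOf
  have hgood : ∀ {b : Fin N → ℤ}, b ∈ 𝒬 → ∀ v ∈ (Face.top N b).carrier h,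
      xOf v ∈ K ∧ dist (F (xOf v)) v ≤ h := by
    intro b hb v hv
    obtain ⟨_, hzb, x', hx', rfl⟩ := hmem𝒬.1 hb
    exact hxOf v ⟨x', hx', dist_le_of_mem_carrier_top hh.le hzb hv⟩
  have hgoodG : ∀ {G : Face N}, G ∈ faces 𝒬 →
      xOf (G.cornerPoint h) ∈ K ∧ dist (F (xOf (G.cornerPoint h))) (G.cornerPoint h) ≤ h := by
    intro G hG
    obtain ⟨b, hb, hGb⟩ := hG
    exact hgood hb _ (Face.carrier_subset_carrier_top hh.le hGb (Face.cornerPoint_mem_carrier hh.le))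
  set p : Face N → M := fun G => xOf (G.cornerPoint h) with hpdef
  -- close lattice data give close anchors
  have hclose : ∀ x ∈ K, ∀ x' ∈ K, dist (F x) (F x') < δ → dist x x' < min ρ (r 0) :=
    fun x hx x' hx' hd => hδF x (hKL' hx) x' (hKL' hx') hd
  have hanchor_close : ∀ G ∈ faces 𝒬, ∀ i ∈ G.S, ∀ up : Bool, dist (p (G.bdFace i up)) (p G) ≤ ρ := by
    intro G hG i hi up
    have h1 := hgoodG hG
    have h2 := hgoodG (bdFace_mem_faces hG hi up)
    have hd : dist (F (xOf ((G.bdFace i up).cornerPoint h))) (F (xOf (G.cornerPoint h))) < δ := by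
      calc dist (F (xOf ((G.bdFace i up).cornerPoint h))) (F (xOf (G.cornerPoint h)))
          ≤ dist (F (xOf ((G.bdFace i up).cornerPoint h))) ((G.bdFace i up).cornerPoint h) +
            dist ((G.bdFace i up).cornerPoint h) (G.cornerPoint h) +
            dist (G.cornerPoint h) (F (xOf (G.cornerPoint h))) := dist_triangle4 _ _ _ _
        _ ≤ h + h + h := by
            gcongr
            · exact h2.2
            · exact Face.dist_cornerPoint_bdFace_le hh.le i up
            · rw [dist_comm]; exact h1.2
        _ < δ := by linarith
    exact ((hclose _ h2.1 _ h1.1 hd).le.trans (min_le_left _ _))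
  -- Step 6: the skeletal extension giving `b`
  let Xb : SkelData N h 𝒬 Unit M E :=
    { r := r, ρ := ρ, Y₀ := L, chart := fun _ q => chartAt E (ctr q),
      cvx := fun k q => ball (chartAt E (ctr q) q) (σ k q), p := p, D := ∅,
      d := fun _ _ => Classical.arbitrary M, S := fun _ => univ }
  have hXb : Xb.Good :=
    { hh := hh
      r_nonneg := fun k => (hrpos k).le
      ρ_nonneg := hρ.le
      tower := fun k hk q hq => ⟨convex_ball _ _, htower k (by omega) q hq⟩
      anchor_mem := fun G hG => hKL' (hgoodG hG).1
      anchor_close := hanchor_close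
      D_closed := fun G hG => absurd hG (notMem_empty G)
      S_anti := fun _ _ _ _ => Subset.rfl
      d_cont := fun G _ hG => absurd hG (notMem_empty G)
      d_mem := fun G _ hG => absurd hG (notMem_empty G) }
  obtain ⟨gb, hgb_cont, -, hgb_mem⟩ := SkelData.exists_extension hXb
  set b : (Fin N → ℝ) → M := fun y => gb () y with hbdef
  have hb_cont_face : ∀ G ∈ faces 𝒬, ContinuousOn b (G.carrier h) := by
    intro G hG
    have := hgb_cont G hG
    exact this.comp (continuous_const.prodMk continuous_id).continuousOn fun y hy => ⟨mem_univ _, hy⟩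
  have hb_mem : ∀ G ∈ faces 𝒬, ∀ y ∈ G.carrier h, b y ∈ closedBall (p G) (r G.S.card) :=
    fun G hG y hy => hgb_mem G hG () (mem_univ _) y hy
  have hclosed_top : ∀ b' : Fin N → ℤ, IsClosed ((Face.top N b').carrier h) := fun b' =>
    (isCompact_carrier_top b').isClosed
  have hb_cont : ContinuousOn b (complex 𝒬 h) := by
    have : complex 𝒬 h = ⋃ b' : ↥𝒬, (Face.top N (b' : Fin N → ℤ)).carrier h := by
      ext y; simp [mem_complex]
    rw [this]
    refine LocallyFinite.continuousOn_iUnion (locallyFinite_of_finite _) (fun b' => hclosed_top _)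
      fun b' => hb_cont_face _ ⟨b', b'.2, Face.top_isFaceOf _⟩
  have hb_U : ∀ y ∈ complex 𝒬 h, b y ∈ U := by
    intro y hy
    obtain ⟨b', hb', hyb'⟩ := mem_complex.1 hy
    have hG : Face.top N b' ∈ faces 𝒬 := ⟨b', hb', Face.top_isFaceOf _⟩
    have h1 := hb_mem _ hG y hyb'
    rw [Face.top_S, Finset.card_univ, Fintype.card_fin] at h1
    exact hrU _ (hKL' (hgoodG hG).1) N (by omega) h1
  -- Step 7: the skeletal extension over the prism giving the homotopy
  set 𝒬' : Finset (Fin (N + 1) → ℤ) := 𝒬.image Prism.liftCube with h𝒬'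
  let XQ : SkelData (N + 1) h 𝒬' M M E :=
    { r := r, ρ := ρ, Y₀ := L, chart := fun _ q => chartAt E (ctr q),
      cvx := fun k q => ball (chartAt E (ctr q) q) (σ k q), p := fun G => p (Prism.proj G),
      D := {G | Fin.last N ∉ G.S},
      d := fun x y => if y (Fin.last N) ≤ h / 2 then x else b (Fin.init y),
      S := fun G => {x ∈ K | F x ∈ starU 𝒬 h (Prism.proj G)} }
  -- parameters are close to the anchor
  have hparam : ∀ G ∈ faces 𝒬, ∀ x ∈ K, F x ∈ starU 𝒬 h G → dist x (p G) < min ρ (r 0) := by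
    intro G hG x hx hFx
    simp only [starU, mem_iUnion] at hFx
    obtain ⟨b', hb', hGb', hFxb⟩ := hFx
    have hc : G.cornerPoint h ∈ (Face.top N b').carrier h :=
      Face.carrier_subset_carrier_top hh.le hGb' (Face.cornerPoint_mem_carrier hh.le)
    have h1 := hgood hb' _ hc
    refine hclose x hx _ h1.1 ?_
    calc dist (F x) (F (xOf (G.cornerPoint h)))
        ≤ dist (F x) (G.cornerPoint h) + dist (G.cornerPoint h) (F (xOf (G.cornerPoint h))) := dist_triangle _ _ _
      _ ≤ h + h := by
          gcongr
          · exact dist_le_of_mem_carrier_top hh.le hFxb hc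
          · rw [dist_comm]; exact h1.2
      _ < δ := by linarith
  have hstar_mono : ∀ (G : Face N) (j : Fin N), j ∈ G.S → ∀ up : Bool,
      starU 𝒬 h G ⊆ starU 𝒬 h (G.bdFace j up) := by
    intro G j hj up y hy
    simp only [starU, mem_iUnion] at hy ⊢
    obtain ⟨b', hb', hGb', hy⟩ := hy
    exact ⟨b', hb', Face.bdFace_isFaceOf hGb' hj up, hy⟩
  have hXQ : XQ.Good :=
    { hh := hh
      r_nonneg := fun k => (hrpos k).le
      ρ_nonneg := hρ.le
      tower := fun k hk q hq => ⟨convex_ball _ _, htower k hk q hq⟩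
      anchor_mem := fun G hG => hKL' (hgoodG (Prism.proj_mem_faces hG)).1
      anchor_close := by
        intro G hG i hi up
        show dist (p (Prism.proj (G.bdFace i up))) (p (Prism.proj G)) ≤ ρ
        refine Fin.lastCases ?_ (fun j hj => ?_) i hi
        · intro _
          rw [Prism.proj_bdFace_last, dist_self]; exact hρ.le
        · rw [Prism.proj_bdFace_castSucc]
          exact hanchor_close _ (Prism.proj_mem_faces hG) j ((Prism.mem_proj_S G j).2 hj) up
      D_closed := by
        intro G hG i _ up
        show Fin.last N ∉ (G.bdFace i up).S
        rw [Face.bdFace_S, Finset.mem_erase, not_and_or]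
        exact Or.inr hG
      S_anti := by
        intro G i hi up x hx
        refine ⟨hx.1, ?_⟩
        show F x ∈ starU 𝒬 h (Prism.proj (G.bdFace i up))
        revert hi
        refine Fin.lastCases ?_ (fun j => ?_) i
        · intro _; rw [Prism.proj_bdFace_last]; exact hx.2
        · intro hj
          rw [Prism.proj_bdFace_castSucc]
          exact hstar_mono _ j ((Prism.mem_proj_S G j).2 hj) up hx.2
      d_cont := by
        intro G hG hGD
        obtain ⟨b', hb', hGb'⟩ := Prism.exists_isFaceOf_liftCube hG
        have hGD' : Fin.last N ∉ G.S := hGD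
        rcases Prism.a_last_of_isFaceOf hGb' with h0 | h1
        · -- bottom: `d = x`
          refine continuous_fst.continuousOn.congr fun q hq => ?_
          have := Prism.apply_last_of_not_mem hq.2 hGD'
          show (if q.2 (Fin.last N) ≤ h / 2 then q.1 else b (Fin.init q.2)) = q.1
          rw [if_pos]; rw [this, h0]; push_cast; linarith
        · -- top: `d = b ∘ init`
          have hc : ContinuousOn (fun q : M × (Fin (N + 1) → ℝ) => b (Fin.init q.2))
              (XQ.S G ×ˢ G.carrier h) := by
            refine hb_cont.comp (Continuous.continuousOn (by fun_prop)) fun q hq => ?_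
            exact carrier_subset_complex hh.le (Prism.proj_mem_faces hG) (Prism.init_mem_carrier_proj hq.2)
          refine hc.congr fun q hq => ?_
          have := Prism.apply_last_of_not_mem hq.2 hGD'
          show (if q.2 (Fin.last N) ≤ h / 2 then q.1 else b (Fin.init q.2)) = b (Fin.init q.2)
          rw [if_neg]; rw [this, h1]; push_cast; linarith
      d_mem := by
        intro G hG hGD x hx y hy
        obtain ⟨b', hb', hGb'⟩ := Prism.exists_isFaceOf_liftCube hG
        have hGD' : Fin.last N ∉ G.S := hGD
        have hylast := Prism.apply_last_of_not_mem hy hGD'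
        have hcard : (Prism.proj G).S.card = G.S.card := Prism.card_proj_S_of_not_mem hGD'
        show (if y (Fin.last N) ≤ h / 2 then x else b (Fin.init y)) ∈
          closedBall (p (Prism.proj G)) (r G.S.card)
        rcases Prism.a_last_of_isFaceOf hGb' with h0 | h1
        · rw [if_pos (by rw [hylast, h0]; push_cast; linarith)]
          have hd := hparam _ (Prism.proj_mem_faces hG) x hx.1 hx.2
          exact mem_closedBall.2 ((hd.le.trans (min_le_right _ _)).trans (hrmono' 0 _ (Nat.zero_le _)))
        · rw [if_neg (by rw [hylast, h1]; push_cast; linarith), ← hcard]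
          exact hb_mem _ (Prism.proj_mem_faces hG) _ (Prism.init_mem_carrier_proj hy) }
  obtain ⟨gQ, hgQ_cont, hgQ_presc, hgQ_mem⟩ := SkelData.exists_extension hXQ
  -- Step 8: the homotopy
  set H : M → ℝ → M := fun x t => gQ x (Fin.snoc (F x) (t * h)) with hHdef
  have hbot : ∀ x ∈ K, H x 0 = x := by
    intro x hx
    obtain ⟨hb', hFx⟩ := hFK x hx
    have hmem := Prism.snoc_mem_carrier_lid hFx false
    simp only [Bool.false_eq_true, ↓reduceIte] at hmem
    have h1 := hgQ_presc _ (Prism.lid_mem_faces hb' false) (Prism.last_not_mem_lid_S _ false) x _ hmem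
    show gQ x (Fin.snoc (F x) (0 * h)) = x
    rw [zero_mul, h1]
    show (if (Fin.snoc (F x) (0 : ℝ) : Fin (N + 1) → ℝ) (Fin.last N) ≤ h / 2 then x else _) = x
    rw [if_pos]; rw [Fin.snoc_last]; linarith
  have htop : ∀ x ∈ K, H x 1 = b (F x) := by
    intro x hx
    obtain ⟨hb', hFx⟩ := hFK x hx
    have hmem := Prism.snoc_mem_carrier_lid hFx true
    simp only [↓reduceIte] at hmem
    have h1 := hgQ_presc _ (Prism.lid_mem_faces hb' true) (Prism.last_not_mem_lid_S _ true) x _ hmem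
    show gQ x (Fin.snoc (F x) (1 * h)) = b (F x)
    rw [one_mul, h1]
    have hlast : (Fin.snoc (F x) h : Fin (N + 1) → ℝ) (Fin.last N) = h := Fin.snoc_last _ _
    have hinit : Fin.init (Fin.snoc (F x) h : Fin (N + 1) → ℝ) = F x := Fin.init_snoc _ _
    change (if (Fin.snoc (F x) h : Fin (N + 1) → ℝ) (Fin.last N) ≤ h / 2 then x
      else b (Fin.init (Fin.snoc (F x) h : Fin (N + 1) → ℝ))) = b (F x)
    rw [hlast, hinit, if_neg (by linarith)]
  -- continuity and image on the pieces over the cubes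
  have hpiece : ∀ b' ∈ 𝒬, ContinuousOn (fun q : M × ℝ => H q.1 q.2)
      ((K ∩ F ⁻¹' (Face.top N b').carrier h) ×ˢ Icc 0 1) ∧
      ∀ x ∈ K, F x ∈ (Face.top N b').carrier h → ∀ t ∈ Icc (0 : ℝ) 1, H x t ∈ U := by
    intro b' hb'
    have hT := Prism.top_liftCube_mem_faces (𝒬 := 𝒬) hb'
    have hS : ∀ x ∈ K, F x ∈ (Face.top N b').carrier h → x ∈ XQ.S (Face.top (N + 1) (Prism.liftCube b')) := by
      intro x hx hFx
      refine ⟨hx, ?_⟩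
      show F x ∈ starU 𝒬 h (Prism.proj (Face.top (N + 1) (Prism.liftCube b')))
      rw [Prism.proj_top]
      simp only [starU, mem_iUnion]
      exact ⟨b', hb', Face.top_isFaceOf _, hFx⟩
    have hcar : ∀ x t, F x ∈ (Face.top N b').carrier h → t ∈ Icc (0 : ℝ) 1 →
        (Fin.snoc (F x) (t * h) : Fin (N + 1) → ℝ) ∈ (Face.top (N + 1) (Prism.liftCube b')).carrier h :=
      fun x t hFx ht => Prism.snoc_mem_carrier_top hFx ⟨by nlinarith [ht.1], by nlinarith [ht.2]⟩
    constructor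
    · have hmap : ContinuousOn (fun q : M × ℝ => (q.1, (Fin.snoc (F q.1) (q.2 * h) : Fin (N + 1) → ℝ)))
          ((K ∩ F ⁻¹' (Face.top N b').carrier h) ×ˢ Icc 0 1) := by
        refine Continuous.continuousOn ?_
        refine continuous_fst.prodMk ?_
        exact (Continuous.finSnoc (A := fun _ : Fin (N + 1) => ℝ) (hFc.comp continuous_fst)
          (continuous_snd.mul continuous_const))
      refine (hgQ_cont _ hT).comp hmap ?_
      rintro ⟨x, t⟩ ⟨⟨hx, hFx⟩, ht⟩
      exact ⟨hS x hx hFx, hcar x t hFx ht⟩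
    · intro x hx hFx t ht
      have h1 := hgQ_mem _ hT x (hS x hx hFx) _ (hcar x t hFx ht)
      rw [Face.top_S, Finset.card_univ, Fintype.card_fin] at h1
      refine hrU _ (hKL' (hgoodG (Prism.proj_mem_faces hT)).1) (N + 1) le_rfl ?_
      exact h1
  refine ⟨N, h, 𝒬, F, b, H, hh, hFc, fun x hx => ?_, hb_cont, hb_U, ?_, hbot, htop, fun x hx t ht => ?_⟩
  · exact mem_complex.2 ⟨_, (hFK x hx).1, (hFK x hx).2⟩
  · have : K ×ˢ Icc (0 : ℝ) 1 = ⋃ b' : ↥𝒬, ((K ∩ F ⁻¹' (Face.top N (b' : Fin N → ℤ)).carrier h) ×ˢ Icc 0 1) := by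
      ext ⟨x, t⟩
      simp only [mem_prod, mem_iUnion, mem_inter_iff, mem_preimage]
      constructor
      · rintro ⟨hx, ht⟩
        exact ⟨⟨_, (hFK x hx).1⟩, ⟨hx, (hFK x hx).2⟩, ht⟩
      · rintro ⟨b', ⟨hx, -⟩, ht⟩; exact ⟨hx, ht⟩
    rw [this]
    refine LocallyFinite.continuousOn_iUnion (locallyFinite_of_finite _) (fun b' => ?_) fun b' => (hpiece _ b'.2).1
    exact ((hK.isClosed.inter ((hclosed_top _).preimage hFc)).prod isClosed_Icc)
  · exact (hpiece _ (hFK x hx).1).2 x hx (hFK x hx).2 t ht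

end Factorization

end Literature.AlgebraicTopology.Homotopy

end
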